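import Summits.AtomisticToContinuum.Crystallization.Theses.ChessboardParticlePlanes
import Summits.AtomisticToContinuum.Crystallization.Theorems.ChessboardParticlePlanesLjPlaneChessboardReduction
import Summits.AtomisticToContinuum.Crystallization.Theorems.ChessboardParticlePlanesLjPlaneChessboardYukawaSliceFourier
import Summits.AtomisticToContinuum.Crystallization.Theorems.ChessboardParticlePlanesLjPlaneChessboardModeExpansion
import Summits.AtomisticToContinuum.Crystallization.Theorems.ChessboardParticlePlanesLjPlaneChessboardHorizontalBasis
import Summits.AtomisticToContinuum.Crystallization.Theorems.ChessboardParticlePlanesLjPlaneChessboardVerticalPeriod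
import Summits.AtomisticToContinuum.Crystallization.Theorems.ChessboardParticlePlanesLjPlaneChessboardHeightEnumeration
import Summits.AtomisticToContinuum.Crystallization.Theorems.ChessboardParticlePlanesLjPlaneChessboardLayerPresentation
import Summits.AtomisticToContinuum.Crystallization.Theorems.ChessboardParticlePlanesLjPlaneChessboardPlanarLattice
import Summits.AtomisticToContinuum.Crystallization.Theorems.ChessboardParticlePlanesLjPlaneChessboardMotifToLayers
import Summits.AtomisticToContinuum.Crystallization.Theorems.ChessboardParticlePlanesLjPlaneChessboardDeficitKernel
import Literature.Algebra.EuclideanLattices.GaussianLatticeSums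

/-!
# Crux `LjPlaneChessboard` (stmt-AtomisticToContinuum-6709) — line `Sketch`, the lead's skeleton
(v9, lead c2: `stub_deficitCore` is now a COMPOSITION over the landed layer/kernel bookkeeping; the ONE open
stub is `stub_kernelFormNonneg` (the certificate theorem in kernel form).
v8, lead c2: stubs 12a `stub_yukawaSliceFourier` p127931, 12b `stub_modeExpansionOfFourier` p127765 and
13 `stub_horizontalBasis` p127668 LANDED (imported); one open stub: `stub_deficitCore`.
v7, continuation lead c2: v6's `stub_yukawaModeExpansion` is split into the Sommerfeld–Weyl
transform `stub_yukawaSliceFourier` + the Poisson bookkeeping `stub_modeExpansionOfFourier`;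
v6, continuation lead c1: the analytic core is RESHAPED into tree-supported infrastructure + one core)

Landed through the gate (all `--supports stmt-AtomisticToContinuum-6709`, namespace
`Summit.AtomisticToContinuum.Crystallization.Theorems.ChessboardParticlePlanesLjPlaneChessboard`,
files `Theorems/ChessboardParticlePlanesLjPlaneChessboard<…>.lean`):

  stub_verticalPeriod  p105859   stub_planarPeriods p104404   stub_restack     p104611
  stub_pointsCongr     p105939   stub_sliceIdentity p105431   stub_yukawaSlicing p104348
  stub_adjacentHeights p107386   stub_restackEnergy p108085   SumToMinLayers   p108292
  stub_sumToMin        p111097   stub_reduction     p113745   (crux ⇐ per-site deficit inequality)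

v5 had ONE open stub, `stub_deficitNonneg` (the per-site chessboard sum-form deficit `≥ 0`).  v6 keeps
its statement as the composition target and splits its proof into

* `stub_yukawaModeExpansion` (L, infrastructure, tree-supported): the planar MODE EXPANSION of one
  Yukawa slice summed over a rank-2 lattice `L` of a 2-dimensional inner-product space,
  `Σ_{λ ∈ L} e^{−m√(‖x−λ‖²+u²)}/√(‖x−λ‖²+u²) = (2π/covol L) Σ_{w ∈ L*} e^{−u√(m²+4π²‖w‖²)}/√(m²+4π²‖w‖²) cos(2π⟪x,w⟫)`
  (`u > 0`, `m > 0`; Sommerfeld–Weyl + Poisson).  Proof route inside the tree: Gaussian subordination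
  `e^{−mr}/r = π^{−1/2} ∫₀^∞ t^{−1/2} e^{−r²t − m²/(4t)} dt` (`integral_rpow_mul_exp_neg_mul_sub_div` with
  `besselK_half_ofReal`, `Literature/Analysis/FunctionSpaces/BesselKMellin.lean`, `BesselKHalf.lean`), the
  shifted Poisson identity for Gaussians `tsum_gaussianFunction_sub_eq`
  (`Literature/Algebra/EuclideanLattices/GaussianLatticeSums.lean`), two Fubini swaps, and the same
  Laplace-type integral with `μ = −1/2` on the dual side.
* `stub_horizontalBasis` (M, bookkeeping): the height-0 periods of `Q` are `ℤa ⊕ ℤb` with `a, b`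
  `ℝ`-independent (from `planarPeriods_exists_basis`: kernel of the height functional on a `ℤ`-basis).
* `stub_deficitCore` (XL, the crux's analytic content): mode expansion → horizontal basis → deficit `≥ 0`.
  Its proof = (i) layer bookkeeping (each occupied plane is a finite union of cosets of the horizontal
  lattice; in-layer and nearest-layer terms cancel per site; only vertical offsets `≥ 3/2` survive),
  (ii) `stub_yukawaSlicing` + `stub_yukawaModeExpansion` + Fubini: the deficit summed over a transversal is
  `(4π/A) ∫₀^∞ (m⁴/144 − m¹⁰/43545600) Σ_{w ∈ Λ₀*} κ_w⁻¹ · SOS_w(e^{−κ_w}) dm`, `κ_w = √(m² + 4π²‖w‖²)`,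
  where `SOS_w` is the right-hand side of `stub_sliceIdentity` for the layer amplitudes
  `a_i(w) = Σ_{p ∈ F_i} e^{2πi⟪p,w⟫}` (twist `ω = e^{2πi⟪δ,w⟫}`, `δ` = horizontal part of the vertical period),
  (iii) DOMINATION of the signed slices `m > 302400^{1/6} = 8.19` (equivalently of the planar modes
  `2π‖w‖ > q*(u)`, `q*(3/2) = 12.317`) on `2/3`-separated layers: the certificate problem of the cards
  (two-layer offset negative type at `u ≥ 3/2` by a forbidden-ball-supported radial test function +
  partner-load accounting, and the column hierarchy for deeper layers).  See
  `Cruxes/LjPlaneChessboard/LineStatus-Sketch.md` for the numerics (no in-class violation; out-of-class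
  square-layer helical stacks DO violate the min-form).
-/

noncomputable section

namespace Summit.AtomisticToContinuum.Crystallization.Theorems.ChessboardParticlePlanesLjPlaneChessboard

open Literature.MathematicalPhysics.StatisticalMechanics
open Literature.Algebra.EuclideanLattices
open scoped Real InnerProductSpace FourierTransform

/-- **The planar mode expansion of a Yukawa slice** (v6's `stub_yukawaModeExpansion`, now a
composition): stub 12b applied to stub 12a. -/
theorem stub_yukawaModeExpansion_of :
    ∀ (V : Type) [NormedAddCommGroup V] [InnerProductSpace ℝ V] [FiniteDimensional ℝ V]
      [MeasurableSpace V] [BorelSpace V] (L : Submodule ℤ V) [DiscreteTopology L] [IsZLattice ℝ L],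
      Module.finrank ℝ V = 2 →
      ∀ (m u : ℝ) (x : V), 0 < m → 0 < u →
        Summable (fun l : L =>
            Real.exp (-(m * Real.sqrt (‖x - l‖ ^ 2 + u ^ 2))) / Real.sqrt (‖x - l‖ ^ 2 + u ^ 2)) ∧
        Summable (fun w : dualLattice L =>
            Real.exp (-(u * Real.sqrt (m ^ 2 + (2 * π * ‖(w : V)‖) ^ 2))) /
                Real.sqrt (m ^ 2 + (2 * π * ‖(w : V)‖) ^ 2) *
              Real.cos (2 * π * ⟪x, (w : V)⟫_ℝ)) ∧
        ∑' l : L, Real.exp (-(m * Real.sqrt (‖x - l‖ ^ 2 + u ^ 2))) / Real.sqrt (‖x - l‖ ^ 2 + u ^ 2) =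
          2 * π / ZLattice.covolume L *
            ∑' w : dualLattice L,
              Real.exp (-(u * Real.sqrt (m ^ 2 + (2 * π * ‖(w : V)‖) ^ 2))) /
                  Real.sqrt (m ^ 2 + (2 * π * ‖(w : V)‖) ^ 2) *
                Real.cos (2 * π * ⟪x, (w : V)⟫_ℝ) :=
  stub_modeExpansionOfFourier stub_yukawaSliceFourier

/-- **Stub 15 — THE ANALYTIC CORE in kernel form (XL; the certificate theorem).**
For an admissible layered configuration presented over one vertical period (layer motifs `F i`,
heights `z i`, horizontal lattice `L`, vertical period `g₀`), the motif-summed chessboard deficit —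
already rewritten (landed `deficit_motif_to_layers`, `deficitSite_kernelForm`) as a finite planar
MATRIX-KERNEL LATTICE FORM over the layer motifs — is non-negative.  This is exactly what the hard-core
certificate must deliver: (Fourier side) the matrix multiplier of the kernel minus the certificate
blocks is positive semi-definite for every planar wavenumber, uniformly in the gaps and Bloch phases
(landed `matrixLatticeFormNonneg`, `fourier_ljCrossKernel`, `sliceTransport`, `sliceWeight_signChange`);
(real side) the certificate blocks have non-negative lattice forms on `2/3`-separated layers (landed
partner accounting, real/weighted/phased, `partnerCount_le_six`).  See `Cruxes/LjPlaneChessboard/Lines/Sketch.md`.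
[cite: GiulianiLebowitzLieb2008, Lemma 1; FrohlichEtAl1978, Thm 3.1] -/
theorem stub_kernelFormNonneg :
    ∀ (Q : PeriodicConfiguration 3) (τu τd : ℝ → ℝ) (a b g₀ : EuclideanSpace ℝ (Fin 3))
      (z : ℤ → ℝ) (n : ℕ) (F : ℤ → Finset (EuclideanSpace ℝ (Fin 3)))
      (L : Submodule ℤ (EuclideanSpace ℝ (Fin 2))) [DiscreteTopology L] [IsZLattice ℝ L],
      (∀ x ∈ Q.points, ∀ y ∈ Q.points, x ≠ y → (2 : ℝ) / 3 ≤ dist x y) →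
      (∀ x' ∈ Q.points, ∀ y ∈ Q.points, x' 2 ≠ y 2 → (3 : ℝ) / 4 ≤ |x' 2 - y 2|) →
      (∀ t : ℝ, (∃ x ∈ Q.points, x 2 = t) →
        (t < τu t ∧ (∃ x ∈ Q.points, x 2 = τu t) ∧ (∀ x ∈ Q.points, x 2 ≤ t ∨ τu t ≤ x 2)) ∧
        (τd t < t ∧ (∃ x ∈ Q.points, x 2 = τd t) ∧ (∀ x ∈ Q.points, x 2 ≤ τd t ∨ t ≤ x 2))) →
      a ∈ Q.lattice → b ∈ Q.lattice → a 2 = 0 → b 2 = 0 → LinearIndependent ℝ ![a, b] →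
      (∀ g ∈ Q.lattice, g 2 = 0 → ∃ k l : ℤ, g = (k : ℝ) • a + (l : ℝ) • b) →
      (∀ v : EuclideanSpace ℝ (Fin 2),
        v ∈ L ↔ ∃ k l : ℤ, v = (k : ℝ) • !₂[a 0, a 1] + (l : ℝ) • !₂[b 0, b 1]) →
      g₀ ∈ Q.lattice → 0 < n → StrictMono z → (∀ i : ℤ, z (i + n) = z i + g₀ 2) →
      (∀ g ∈ Q.lattice, ∃ k : ℤ, g 2 = g₀ 2 * k) →
      (∀ y ∈ Q.points, ∃ i : ℤ, y 2 = z i) → (∀ i : ℤ, ∃ y ∈ Q.points, y 2 = z i) →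
      (∀ i : ℤ, z (i + 1) = τu (z i)) → (∀ i : ℤ, τd (z (i + 1)) = z i) →
      (∀ m : ℤ, ∀ f ∈ F m, f 2 = z m ∧ f ∈ Q.points) →
      (∀ m : ℤ, ∀ f ∈ F m, ∀ f' ∈ F m, f ≠ f' → ∀ k l : ℤ, f' ≠ f + (k : ℝ) • a + (l : ℝ) • b) →
      (∀ (m : ℤ) (y : EuclideanSpace ℝ (Fin 3)),
        (y ∈ Q.points ∧ y 2 = z m) ↔ ∃ f ∈ F m, ∃ k l : ℤ, y = f + (k : ℝ) • a + (l : ℝ) • b) →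
      (∀ m : ℤ, F (m + n) = (F m).image (fun f => f + g₀)) →
      0 ≤ ∑ i₀ ∈ Finset.range n, ∑ x ∈ F i₀,
        ∑ m ∈ Finset.range n, ∑ f' ∈ F m, ∑' v : L,
        ∑' j : ℤ,
          ((if (m : ℤ) + j * n = (i₀ : ℤ) then 0 else
              2 * lennardJones (Real.sqrt
                (‖!₂[x 0, x 1] - !₂[f' 0, f' 1] - (j : ℝ) • !₂[g₀ 0, g₀ 1]
                    - (v : EuclideanSpace ℝ (Fin 2))‖ ^ 2 + (z (i₀ : ℤ) - z ((m : ℤ) + j * n)) ^ 2)))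
            - (if (m : ℤ) + j * n = (i₀ : ℤ) then
                ∑' k : {k : ℤ // k ≠ 0},
                  (lennardJones (Real.sqrt
                      (‖!₂[x 0, x 1] - !₂[f' 0, f' 1] - (v : EuclideanSpace ℝ (Fin 2))‖ ^ 2
                        + (2 * |(k : ℝ)| * (z ((i₀ : ℤ) + 1) - z (i₀ : ℤ))) ^ 2)) +
                   lennardJones (Real.sqrt
                      (‖!₂[x 0, x 1] - !₂[f' 0, f' 1] - (v : EuclideanSpace ℝ (Fin 2))‖ ^ 2
                        + (2 * |(k : ℝ)| * (z (i₀ : ℤ) - z ((i₀ : ℤ) - 1))) ^ 2)))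
               else 0)
            - (if (m : ℤ) + j * n = (i₀ : ℤ) + 1 then
                ∑' k : ℤ, lennardJones (Real.sqrt
                  (‖!₂[x 0, x 1] - !₂[f' 0, f' 1] - (j : ℝ) • !₂[g₀ 0, g₀ 1]
                      - (v : EuclideanSpace ℝ (Fin 2))‖ ^ 2
                    + (|2 * (k : ℝ) + 1| * (z ((i₀ : ℤ) + 1) - z (i₀ : ℤ))) ^ 2))
               else 0)
            - (if (m : ℤ) + j * n = (i₀ : ℤ) - 1 then
                ∑' k : ℤ, lennardJones (Real.sqrt
                  (‖!₂[x 0, x 1] - !₂[f' 0, f' 1] - (j : ℝ) • !₂[g₀ 0, g₀ 1]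
                      - (v : EuclideanSpace ℝ (Fin 2))‖ ^ 2
                    + (|2 * (k : ℝ) + 1| * (z (i₀ : ℤ) - z ((i₀ : ℤ) - 1))) ^ 2))
               else 0)) := by
  sorry

/-- **v6's Stub 14, now a COMPOSITION (lead c2, v9)**: the per-site chessboard deficit inequality
for Lennard-Jones follows from the kernel-form core (stub 15) through the landed bookkeeping:
vertical period (`stub_verticalPeriod`), horizontal basis (hypothesis), height enumeration
(`heightEnumeration`), periodic layer presentation (`layerPresentation_periodic`), planar lattice
(`planarLattice`), re-summation over the layer motifs (`deficit_motif_to_layers`) and the per-site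
kernel form (`deficitSite_kernelForm`).  (The mode-expansion hypothesis is no longer consumed here; it
is part of the Fourier side of stub 15.) -/
theorem stub_deficitCore :
    (∀ (V : Type) [NormedAddCommGroup V] [InnerProductSpace ℝ V] [FiniteDimensional ℝ V]
      [MeasurableSpace V] [BorelSpace V] (L : Submodule ℤ V) [DiscreteTopology L] [IsZLattice ℝ L],
      Module.finrank ℝ V = 2 →
      ∀ (m u : ℝ) (x : V), 0 < m → 0 < u →
        Summable (fun l : L =>
            Real.exp (-(m * Real.sqrt (‖x - l‖ ^ 2 + u ^ 2))) / Real.sqrt (‖x - l‖ ^ 2 + u ^ 2)) ∧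
        Summable (fun w : dualLattice L =>
            Real.exp (-(u * Real.sqrt (m ^ 2 + (2 * π * ‖(w : V)‖) ^ 2))) /
                Real.sqrt (m ^ 2 + (2 * π * ‖(w : V)‖) ^ 2) *
              Real.cos (2 * π * ⟪x, (w : V)⟫_ℝ)) ∧
        ∑' l : L, Real.exp (-(m * Real.sqrt (‖x - l‖ ^ 2 + u ^ 2))) / Real.sqrt (‖x - l‖ ^ 2 + u ^ 2) =
          2 * π / ZLattice.covolume L *
            ∑' w : dualLattice L,
              Real.exp (-(u * Real.sqrt (m ^ 2 + (2 * π * ‖(w : V)‖) ^ 2))) /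
                  Real.sqrt (m ^ 2 + (2 * π * ‖(w : V)‖) ^ 2) *
                Real.cos (2 * π * ⟪x, (w : V)⟫_ℝ)) →
    (∀ Q : PeriodicConfiguration 3,
      (∃ c₀ : ℝ, 0 < c₀ ∧ (∃ g ∈ Q.lattice, g 2 = c₀) ∧ ∀ g ∈ Q.lattice, ∃ k : ℤ, g 2 = c₀ * k) →
      ∃ a ∈ Q.lattice, ∃ b ∈ Q.lattice, a 2 = 0 ∧ b 2 = 0 ∧ LinearIndependent ℝ ![a, b] ∧
        ∀ g ∈ Q.lattice, g 2 = 0 → ∃ k l : ℤ, g = (k : ℝ) • a + (l : ℝ) • b) →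
    ∀ (Q : PeriodicConfiguration 3) (τu τd : ℝ → ℝ),
      (∀ x ∈ Q.points, ∀ y ∈ Q.points, x ≠ y → (2 : ℝ) / 3 ≤ dist x y) →
      (∀ x ∈ Q.points, ∀ y ∈ Q.points, x 2 ≠ y 2 → (3 : ℝ) / 4 ≤ |x 2 - y 2|) →
      (∀ t : ℝ, (∃ x ∈ Q.points, x 2 = t) →
        (t < τu t ∧ (∃ x ∈ Q.points, x 2 = τu t) ∧ (∀ x ∈ Q.points, x 2 ≤ t ∨ τu t ≤ x 2)) ∧
        (τd t < t ∧ (∃ x ∈ Q.points, x 2 = τd t) ∧ (∀ x ∈ Q.points, x 2 ≤ τd t ∨ t ≤ x 2))) →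
      0 ≤ ∑ x ∈ Q.motif,
        (2 * (∑' y : {y : EuclideanSpace ℝ (Fin 3) // y ∈ Q.points ∧ y ≠ x},
                lennardJones (dist x y.1))
          - (∑' y : {y : EuclideanSpace ℝ (Fin 3) //
                y ∈ {p : EuclideanSpace ℝ (Fin 3) | ∃ k : ℤ, ∃ x' ∈ Q.points,
                  (x' 2 = x 2 ∨ x' 2 = τu (x 2)) ∧
                  p = x' + ((2 * (τu (x 2) - x 2)) * (k : ℝ)) •
                    EuclideanSpace.single (2 : Fin 3) (1 : ℝ)} ∧ y ≠ x},
                lennardJones (dist x y.1))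
          - (∑' y : {y : EuclideanSpace ℝ (Fin 3) //
                y ∈ {p : EuclideanSpace ℝ (Fin 3) | ∃ k : ℤ, ∃ x' ∈ Q.points,
                  (x' 2 = τd (x 2) ∨ x' 2 = x 2) ∧
                  p = x' + ((2 * (x 2 - τd (x 2))) * (k : ℝ)) •
                    EuclideanSpace.single (2 : Fin 3) (1 : ℝ)} ∧ y ≠ x},
                lennardJones (dist x y.1))) := by
  intro _hME hHB Q τu τd hsep hgap Hτ
  classical
  -- vertical period, horizontal basis, height enumeration
  obtain ⟨c₀, hc₀, ⟨g₀, hg₀, hg₀2⟩, hvert⟩ := stub_verticalPeriod Q hgap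
  obtain ⟨a, ha, b, hb, ha2, hb2, hab, hspan⟩ := hHB Q ⟨c₀, hc₀, ⟨g₀, hg₀, hg₀2⟩, hvert⟩
  obtain ⟨n, z, hn, hz, hzu, hzd, hper, hocc, hcov⟩ :=
    heightEnumeration Q τu τd c₀ hgap Hτ hc₀ ⟨g₀, hg₀, hg₀2⟩ hvert
  have hper' : ∀ i : ℤ, z (i + n) = z i + g₀ 2 := fun i => by rw [hg₀2]; exact hper i
  have hvert' : ∀ g ∈ Q.lattice, ∃ k : ℤ, g 2 = g₀ 2 * k := fun g hg => by
    rw [hg₀2]; exact hvert g hg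
  have hcov' : ∀ y ∈ Q.points, ∃ i : ℤ, y 2 = z i := fun y hy => by
    obtain ⟨i, hi⟩ := hcov (y 2) ⟨y, hy, rfl⟩
    exact ⟨i, hi.symm⟩
  -- periodic layer presentation and the planar lattice
  obtain ⟨F, _hFcard, hFmem, hFsep, hFchar, hFper⟩ :=
    layerPresentation_periodic Q a b g₀ z n ha hb ha2 hb2 hab hspan hg₀ hn hz hper' hcov'
  obtain ⟨L, hLd, hLz, hLmem⟩ := planarLattice a b ha2 hb2 hab
  haveI : DiscreteTopology L := hLd
  haveI : IsZLattice ℝ L := hLz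
  -- re-sum over the layer motifs and pass to the kernel form site by site
  rw [deficit_motif_to_layers Q τu τd a b g₀ z n F Hτ ha hb ha2 hb2 hspan hg₀ hn hz hper' hvert'
    hcov' hFmem hFsep hFchar hFper]
  rw [Finset.sum_congr rfl fun i₀ hi₀ => Finset.sum_congr rfl fun x hx =>
    deficitSite_kernelForm Q τu τd a b g₀ z n F L i₀ x hgap ha hb ha2 hb2 hab hLmem hg₀ hn hz hper'
      hcov' hocc hzu hzd hFmem hFsep hFchar hFper (Finset.mem_range.1 hi₀) hx]
  exact stub_kernelFormNonneg Q τu τd a b g₀ z n F L hsep hgap Hτ ha hb ha2 hb2 hab hspan hLmem hg₀ hn hz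
    hper' hvert' hcov' hocc hzu hzd hFmem hFsep hFchar hFper

/-- **The per-site chessboard deficit inequality** (v5's `stub_deficitNonneg`, now a composition):
core (stub 14) applied to the mode expansion (stub 12) and the horizontal basis (stub 13). -/
theorem stub_deficitNonneg_of :
    ∀ (Q : PeriodicConfiguration 3) (τu τd : ℝ → ℝ),
      (∀ x ∈ Q.points, ∀ y ∈ Q.points, x ≠ y → (2 : ℝ) / 3 ≤ dist x y) →
      (∀ x ∈ Q.points, ∀ y ∈ Q.points, x 2 ≠ y 2 → (3 : ℝ) / 4 ≤ |x 2 - y 2|) →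
      (∀ t : ℝ, (∃ x ∈ Q.points, x 2 = t) →
        (t < τu t ∧ (∃ x ∈ Q.points, x 2 = τu t) ∧ (∀ x ∈ Q.points, x 2 ≤ t ∨ τu t ≤ x 2)) ∧
        (τd t < t ∧ (∃ x ∈ Q.points, x 2 = τd t) ∧ (∀ x ∈ Q.points, x 2 ≤ τd t ∨ t ≤ x 2))) →
      0 ≤ ∑ x ∈ Q.motif,
        (2 * (∑' y : {y : EuclideanSpace ℝ (Fin 3) // y ∈ Q.points ∧ y ≠ x},
                lennardJones (dist x y.1))
          - (∑' y : {y : EuclideanSpace ℝ (Fin 3) //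
                y ∈ {p : EuclideanSpace ℝ (Fin 3) | ∃ k : ℤ, ∃ x' ∈ Q.points,
                  (x' 2 = x 2 ∨ x' 2 = τu (x 2)) ∧
                  p = x' + ((2 * (τu (x 2) - x 2)) * (k : ℝ)) •
                    EuclideanSpace.single (2 : Fin 3) (1 : ℝ)} ∧ y ≠ x},
                lennardJones (dist x y.1))
          - (∑' y : {y : EuclideanSpace ℝ (Fin 3) //
                y ∈ {p : EuclideanSpace ℝ (Fin 3) | ∃ k : ℤ, ∃ x' ∈ Q.points,
                  (x' 2 = τd (x 2) ∨ x' 2 = x 2) ∧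
                  p = x' + ((2 * (x 2 - τd (x 2))) * (k : ℝ)) •
                    EuclideanSpace.single (2 : Fin 3) (1 : ℝ)} ∧ y ≠ x},
                lennardJones (dist x y.1))) :=
  stub_deficitCore stub_yukawaModeExpansion_of stub_horizontalBasis

/-- **Composition**: the landed reduction `stub_reduction` (p113745) applied to the deficit inequality
closes the crux BY NAME. -/
theorem LjPlaneChessboard_of :
    Summit.AtomisticToContinuum.Crystallization.Theses.ChessboardParticlePlanes.LjPlaneChessboard :=
  stub_reduction stub_deficitNonneg_of

end Summit.AtomisticToContinuum.Crystallization.Theorems.ChessboardParticlePlanesLjPlaneChessboard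

end
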